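import Summits.BirchSwinnertonDyer.BirchSwinnertonDyer.Theses.PAdicOrderV2
import Summits.BirchSwinnertonDyer.BirchSwinnertonDyer.Theorems.PAdicOrderV2PAdicOrderComparisonR2StubParity
import Summits.BirchSwinnertonDyer.BirchSwinnertonDyer.Theorems.PAdicOrderV2PAdicOrderRankOneR4OneLeOrder
import Literature.NumberTheory.EllipticCurves.PAdicGrossZagier

/-!
# Negative lemmas for crux `PAdicOrderV2.PAdicOrderRankOneR4` (stmt-BirchSwinnertonDyer-0515):
# the exact shape of a counterexample, and what the crux costs (rank-one Schneider)

Refuter (cdisprove) support file; nothing here asserts a route statement.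

1. **Shape of a counterexample (unconditional).** Under the crux's hypotheses (`p` good ordinary —
   `p = 2` allowed —, `W.analyticRank = 1`, `f` the newform of `W` at any level) the tree already
   proves `1 ≤ ord_T L_p(E,T)` (`TameShadow.stub_one_le_order`, interpolation) and
   `ord_T L_p ≡ r_an (mod 2)` (`stub_even_order_iff_even_analyticRank`, the `p`-adic functional
   equation; Greenberg LNM 1716 §5), and `L_p ≠ 0` (Rohrlich, `padicLFunction_ne_zero_holds`).
   Hence `ord_T L_p` is ODD and finite, the crux at `(W,p,f)` is equivalent to `coeff_1 L_p ≠ 0`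
   (`order_eq_one_iff_coeff_one_ne_zero`), and it FAILS iff `3 ≤ ord_T L_p`
   (`order_ne_one_iff_three_le_order`, `not_PAdicOrderRankOneR4_iff`): a refutation must exhibit a
   rank-one curve whose `p`-adic `L`-function vanishes to order at least THREE — numerically, a
   vanishing `p`-adic regulator, never observed (kit jobs j016547/j016704 of this seat: 351 pairs
   `(E,p)`, `N ≤ 330`, `p ∈ {2,3,5,7}`, all with `coeff_1 ≠ 0`).
2. **What the crux costs (modulo Perrin-Riou 1987).** In Perrin-Riou's setting (`p ≥ 5` split in a
   Heegner field `K`, unit twist factor) the crux forces the canonical cyclotomic `p`-adic height of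
   the Heegner point to be non-zero (`height_ne_zero_of_PAdicOrderRankOneR4`) — rank-one Schneider
   non-degeneracy, open for non-CM curves (barrier `PAdicHeightBarrier`; Mazur–Stein–Tate 2006,
   Conj. 1.1). This is the precise sense in which the crux "is" Schneider's conjecture in rank one.
-/

set_option linter.dupNamespace false

noncomputable section

namespace Summit.BirchSwinnertonDyer.BirchSwinnertonDyer.Theorems.PAdicOrderRankOneR4.Negative

open CongruenceSubgroup PowerSeries NumberField
open Summit.BirchSwinnertonDyer.BirchSwinnertonDyer.Theses.PAdicOrderV2
open Summit.BirchSwinnertonDyer.BirchSwinnertonDyer.Theorems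
open Literature.NumberTheory.EllipticCurves Literature.NumberTheory.EllipticCurves.ModularForms

section Shape

variable (W : WeierstrassCurve ℚ) [W.IsElliptic] [W.IsGloballyMinimal] (p : ℕ) [Fact p.Prime]
  (hord : IsOrdinaryAt W p) (hr : W.analyticRank = 1) {N : ℕ} [NeZero N]
  (f : CuspForm (Gamma0 N) 2) (hf : IsNewformOf W f)

include hord hr hf

/-- **In analytic rank one, `ord_T L_p(E,T)` is a finite ODD number** (any good ordinary `p`,
`p = 2` included; newform at any level): parity `ord_T L_p ≡ r_an = 1 (mod 2)`
(`stub_even_order_iff_even_analyticRank`) and `L_p ≠ 0` (`padicLFunction_ne_zero_holds`).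
[cite: GreenbergLNM1716, §5 (p. 181)] -/
theorem exists_order_eq_coe_odd :
    ∃ n : ℕ, (padicLFunction f (unitRoot W p : ℚ_[p])).order = n ∧ Odd n := by
  have hpar := stub_even_order_iff_even_analyticRank W p hord f hf
  rw [hr] at hpar
  have hfin : (padicLFunction f (unitRoot W p : ℚ_[p])).order ≠ ⊤ := by
    rw [Ne, order_eq_top]
    exact padicLFunction_ne_zero_holds (W := W) (p := p) (f := f) hord hf
  refine ⟨(padicLFunction f (unitRoot W p : ℚ_[p])).order.toNat, (ENat.coe_toNat hfin).symm, ?_⟩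
  rw [← Nat.not_even_iff_odd, hpar]
  decide

/-- **A counterexample has `ord_T L_p ≥ 3`.** Under the crux's hypotheses,
`ord_T L_p(E,T) ≠ 1 ↔ 3 ≤ ord_T L_p(E,T)` (the order is odd). So refuting the crux at `(E, p)` means
`L_p'(0) = L_p''(0) = 0`: a vanishing `p`-adic regulator together with a further vanishing.
[cite: GreenbergLNM1716, §5 (p. 181)] -/
theorem order_ne_one_iff_three_le_order :
    (padicLFunction f (unitRoot W p : ℚ_[p])).order ≠ 1 ↔
      (3 : ℕ∞) ≤ (padicLFunction f (unitRoot W p : ℚ_[p])).order := by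
  obtain ⟨n, hn, hodd⟩ := exists_order_eq_coe_odd W p hord hr f hf
  rw [hn]
  constructor
  · intro h1
    have hn1 : n ≠ 1 := fun h => h1 (by rw [h]; rfl)
    obtain ⟨k, rfl⟩ := hodd
    have : 3 ≤ 2 * k + 1 := by omega
    exact_mod_cast this
  · intro h3 h1
    have h3' : 3 ≤ n := by exact_mod_cast h3
    have h1' : n = 1 := by exact_mod_cast h1
    omega

/-- **Pointwise reformulation of the crux**: under its hypotheses, `ord_T L_p(E,T) = 1 ↔ L_p'(E,0) ≠ 0`
(`coeff_1 ≠ 0`), because `L_p(E,0) = 0` is already a theorem (`TameShadow.stub_one_le_order`).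
[cite: MazurTateTeitelbaum1986Invent, §I.14 (14.3)] -/
theorem order_eq_one_iff_coeff_one_ne_zero :
    (padicLFunction f (unitRoot W p : ℚ_[p])).order = 1 ↔
      coeff 1 (padicLFunction f (unitRoot W p : ℚ_[p])) ≠ 0 := by
  have h1 := TameShadow.stub_one_le_order W p hord hr f hf
  rw [show (1 : ℕ∞) = ((1 : ℕ) : ℕ∞) from rfl, order_eq_nat]
  constructor
  · exact fun h => h.1
  · intro h
    refine ⟨h, fun i hi => ?_⟩
    obtain rfl : i = 0 := by omega
    exact coeff_of_lt_order 0 (lt_of_lt_of_le (by exact_mod_cast Nat.zero_lt_one) h1)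

end Shape

/-- **What a refutation of the crux must produce** (unconditional): `PAdicOrderRankOneR4` fails iff
some elliptic `W/ℚ` (globally minimal) of analytic rank one, some good ordinary `p` and the newform
`f` of `W` have `3 ≤ ord_T L_p(E,T)`. [cite: GreenbergLNM1716, §5 (p. 181)] -/
theorem not_PAdicOrderRankOneR4_iff :
    ¬ PAdicOrderRankOneR4 ↔
      ∃ (W : WeierstrassCurve ℚ) (_ : W.IsElliptic) (_ : W.IsGloballyMinimal) (p : ℕ)
        (_ : Fact p.Prime), IsOrdinaryAt W p ∧ W.analyticRank = 1 ∧
        ∃ (N : ℕ) (_ : NeZero N) (f : CuspForm (Gamma0 N) 2), IsNewformOf W f ∧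
          (3 : ℕ∞) ≤ (padicLFunction f (unitRoot W p : ℚ_[p])).order := by
  constructor
  · intro h
    by_contra hne
    apply h
    intro W _ _ p _ hord hr N _ f hf
    by_contra h1
    exact hne ⟨W, ‹_›, ‹_›, p, ‹_›, hord, hr, N, ‹_›, f, hf,
      (order_ne_one_iff_three_le_order W p hord hr f hf).mp h1⟩
  · rintro ⟨W, _, _, p, _, hord, hr, N, _, f, hf, h3⟩ hcrux
    exact (order_ne_one_iff_three_le_order W p hord hr f hf).mpr h3 (hcrux W p hord hr f hf)

section Height

variable {W : WeierstrassCurve ℚ} [W.IsElliptic] [W.IsGloballyMinimal] {p : ℕ} [Fact p.Prime]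
  {K : Type} [Field K] [NumberField K] {N : ℕ} [NeZero N]
  {Nf Ng : ℕ} [NeZero Nf] [NeZero Ng] {f : CuspForm (Gamma0 Nf) 2} {g : CuspForm (Gamma0 Ng) 2}

/-- **The crux implies rank-one Schneider non-degeneracy for Heegner points** (modulo the tree fact
`perrinRiou_padicGrossZagier`, Perrin-Riou 1987 Thm 1.3). In Perrin-Riou's setting — `p ≥ 5` good
ordinary and split in the imaginary quadratic `K` (odd `d_K` coprime to `N = N_E`, Heegner
hypothesis), `DK` THE canonical cyclotomic `p`-adic height datum, `P` a Heegner point of level `N` —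
if `E` has analytic rank one and the twist factor `L_p(E^{(d_K)}, T)` is a unit (`order = 0`, i.e.
`L(E^{(d_K)}, 1) ≠ 0`, the standard choice of `K`), then `PAdicOrderRankOneR4` forces
`⟨P_K, P_K⟩_p ≠ 0`: `ord L_p(E/K) = ord L_p(E) + ord L_p(E^D) = 1 + 0` and Perrin-Riou's
`order_eq_one_iff`. A counterexample to the crux at such a `p` is therefore exactly a degenerate
canonical height on a rank-one curve (Mazur–Stein–Tate 2006, Conj. 1.1 says there is none).
[cite: PerrinRiou1987, Thm. 1.3] -/
theorem height_ne_zero_of_PAdicOrderRankOneR4 (hcrux : PAdicOrderRankOneR4)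
    (h : perrinRiou_padicGrossZagier)
    (hf : IsNewformOf W f) (hg : IsNewformOf (W.quadraticTwist (NumberField.discr K : ℚ)) g)
    (hp : 5 ≤ p) (hgood : W.HasGoodReductionAtPrime p) (hord : ¬ (p : ℤ) ∣ W.frobeniusTrace p)
    (hK : IsImaginaryQuadratic K) (hodd : Odd (NumberField.discr K))
    (hcop : IsCoprime (NumberField.discr K) (N : ℤ)) (hN : W.conductorNorm ℤ = N)
    (hH : SatisfiesHeegnerHypothesis N K)
    (hsplit : ((Ideal.span {(p : ℤ)}).primesOver (𝓞 K)).ncard = 2)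
    {DK : WeierstrassCurve.PAdicHeightDataK W p K} (hDK : DK.IsCanonical)
    {P : (W.baseChange K).toAffine.Point} (hP : IsHeegnerPoint N W K P)
    (hr : W.analyticRank = 1)
    (htw : (padicLFunction g (twistUnitRoot W p K)).order = 0) :
    DK.height P ≠ 0 := by
  have h1 : (padicLFunction f (unitRoot W p : ℚ_[p])).order = 1 := hcrux W p ⟨hgood, hord⟩ hr f hf
  have hK1 : (padicLFunctionEK W p K hf hg).order = 1 := by
    show (padicLFunction f (unitRoot W p : ℚ_[p]) * padicLFunction g (twistUnitRoot W p K)).order = 1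
    rw [order_mul, h1, htw, add_zero]
  exact (h.order_eq_one_iff hf hg hp hgood hord hK hodd hcop hN hH hsplit hDK hP).mp hK1

end Height

end Summit.BirchSwinnertonDyer.BirchSwinnertonDyer.Theorems.PAdicOrderRankOneR4.Negative

end
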